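import Mathlib
import HarnessLib
import Summits.PneNP.PneNP.Theses.KrwChromaticSteering
import Summits.PneNP.PneNP.Theorems.KrwChromaticSteeringCompositionIteration

/-!
# `CompositionIterationFrac` — FRACTIONAL weak KRW ⇒ `P ⊄ NC¹` (door support, PROVED)

Crux `StrongComposition` (stmt-PneNP-18538), seat pnp-ideate-p5 (g5, lens `embed`).  The two door
lines of this crux — `inner-fraction-door` (`Cruxes/StrongComposition/InnerFractionDoorSketch.lean`) and
`easy-outer-door` (`…/EasyOuterDoorSketch.lean`) — and the slice host's fraction form
(`SliceSemiMonotone.SliceStrongCompositionFrac`, v3/v4) all decide the sub-problem through ONE unproved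
support statement, the door card's "first lemma"

  `CompositionIterationFrac : WeakKRWFrac → ∃ L ∈ P, L ∉ NC¹`

(weak KRW in depth form with only a constant FRACTION `n / k` of the inner depth gained per level;
GMWW 2017 fn. 3 (ii); KRW95 §5; Meir 2023 §1 Prop. 1).  This file PROVES it
(`compositionIterationFrac_holds`), by re-running the landed KRW iteration
(`Theorems/KrwChromaticSteeringCompositionIterationIterate.lean`, `iterate_levels` /
`exists_hard_function_of_weakKRW`) with `d = k·(c₀+1)` levels instead of `c₀+1` and inner arity `K = 2^t`
chosen with `((c₀+1)k + c d² + c₀ d)(t+1) < 2^t`; the circuit side (`stub_cvp`, Karchmer–Wigderson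
`exists_solves_of_computes`) is reused unchanged through the factored-out contradiction
`not_NC1_of_hardFunctions`.  Consequently the door glue no longer carries `CompositionIterationFrac` as a
hypothesis: `closes_frac : StrongCompositionFrac → StandardFromStrong → FormulaLayerLift → PneNP`
(kernel-checked below), and with v4 of `SliceSemiMonotone.lean` (`StrongCompositionFrac ↔
SliceStrongCompositionFrac`) the slice host's C₀-frac decides the sub-problem on the same terms.

Statements shared with the non-importable sketch modules are restated VERBATIM (same bodies) and marked so.
Honest framing: a CONDITIONAL glue step — weak KRW (fractional or not) is an open conjecture and is only
ever a hypothesis here; nothing in this file bears on P vs NP beyond the printed implication.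
-/

set_option linter.dupNamespace false
set_option autoImplicit false

namespace Summit.PneNP.PneNP.Cruxes.StrongComposition.CompositionIterationFrac

open Literature.Computability.Complexity
open Summit.PneNP.PneNP.Theorems.KrwCompositionIteration

/-- Weak KRW in depth form with a constant fraction `n / k` of the inner depth gained — verbatim body of
`InnerFractionDoor.WeakKRWFrac`. OPEN conjecture (hypothesis only). -/
def WeakKRWFrac : Prop :=
  ∃ c k : ℕ, 0 < k ∧ ∀ m n : ℕ, 1 ≤ n → ∀ f : (Fin m → Bool) → Bool, (∃ a b, f a ≠ f b) →
    ∃ g : (Fin n → Bool) → Bool, ∀ P : KWTree (Fin m × Fin n), P.Solves (blockComp f g) →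
      ∃ Q : KWTree (Fin m), Q.Solves f ∧ Q.depth + n / k ≤ P.depth + c * (Nat.log 2 (m * n) + 1)

/-- The door's first lemma — verbatim body of `InnerFractionDoor.CompositionIterationFrac`. -/
def CompositionIterationFrac : Prop :=
  WeakKRWFrac → ∃ L ∈ Classes.P, L ∉ NC1

/-! ### The iteration with fractional gain -/

/-- **The KRW iteration, level by level, fractional gain.** As `iterate_levels`, with the per-level
gain `k / K` in place of `k`: under fractional weak KRW (constants `c`, `K`), for inner arity `k ≥ 1`
and `d` levels with `c·d·(⌊log₂ k⌋+1) < k / K`, every `j ≤ d` has a non-constant `h_j` on `k^j` bits whose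
KW game needs depth `≥ j·(k/K) − j·c·d·(⌊log₂ k⌋+1)` and which has a `B₂`-program of
`≤ j · k^j · univBound k` gates. -/
theorem iterate_levels_frac {c K : ℕ}
    (hweak : ∀ m n : ℕ, 1 ≤ n → ∀ f : (Fin m → Bool) → Bool, (∃ a b, f a ≠ f b) →
      ∃ g : (Fin n → Bool) → Bool, ∀ P : KWTree (Fin m × Fin n), P.Solves (blockComp f g) →
        ∃ Q : KWTree (Fin m), Q.Solves f ∧ Q.depth + n / K ≤ P.depth + c * (Nat.log 2 (m * n) + 1))
    {k d : ℕ} (hk : 1 ≤ k) (hB : c * (d * (Nat.log 2 k + 1)) < k / K) :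
    ∀ j : ℕ, j ≤ d → ∃ N : ℕ, N = k ^ j ∧ ∃ h : (Fin N → Bool) → Bool,
      (∃ a b, h a ≠ h b) ∧
      (∀ Q : KWTree (Fin N), Q.Solves h →
        j * (k / K) ≤ Q.depth + j * (c * (d * (Nat.log 2 k + 1)))) ∧
      CktSize B2 (fun x (_ : Unit) => h x) (j * (N * univBound k))
  | 0, _ => by
    refine ⟨1, (pow_zero k).symm, fun x => x 0, ⟨fun _ => true, fun _ => false, by simp⟩,
      fun Q _ => by simp, ?_⟩
    simpa using CktSize.proj B2 (fun _ : Unit => (0 : Fin 1))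
  | j + 1, hj => by
    obtain ⟨N, hN, h, hnc, hlb, hck⟩ := iterate_levels_frac hweak hk hB j (Nat.le_of_succ_le hj)
    obtain ⟨g, hg⟩ := hweak N k hk h hnc
    -- per-level loss: `c (⌊log₂ (N k)⌋ + 1) ≤ c d (⌊log₂ k⌋ + 1)`
    have hloss : c * (Nat.log 2 (N * k) + 1) ≤ c * (d * (Nat.log 2 k + 1)) := by
      refine Nat.mul_le_mul_left c ?_
      rw [hN, ← pow_succ]
      exact (log_pow_succ_le k j).trans (Nat.mul_le_mul_right _ hj)
    -- the new function `h' = h ⋄ g`, row-major on `N * k` bits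
    have hlb' : ∀ Q : KWTree (Fin (N * k)),
        Q.Solves (fun x => blockComp h g fun p => x (finProdFinEquiv p)) →
          (j + 1) * (k / K) ≤ Q.depth + (j + 1) * (c * (d * (Nat.log 2 k + 1))) := by
      intro Q hQ
      obtain ⟨P, hP, hPd⟩ := exists_solves_blockComp_of_rowMajor h g Q hQ
      obtain ⟨Q₀, hQ₀, hd⟩ := hg P hP
      have ih := hlb Q₀ hQ₀
      rw [hPd] at hd
      rw [Nat.succ_mul, Nat.succ_mul]
      generalize k / K = q at ih hd ⊢
      generalize c * (d * (Nat.log 2 k + 1)) = B at ih hloss ⊢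
      generalize c * (Nat.log 2 (N * k) + 1) = B' at hd hloss
      generalize j * q = jq at ih ⊢
      generalize j * B = jB at ih ⊢
      omega
    have hnc' : ∃ a b, (fun x : Fin (N * k) → Bool => blockComp h g fun p => x (finProdFinEquiv p)) a ≠
        (fun x : Fin (N * k) → Bool => blockComp h g fun p => x (finProdFinEquiv p)) b := by
      by_contra hall
      have hNk : 0 < N * k := by
        rw [hN, ← pow_succ]; exact Nat.pow_pos hk
      have hsol := solves_of_forall_eq (KWTree.leaf (⟨0, hNk⟩ : Fin (N * k)))
        (h := fun x : Fin (N * k) → Bool => blockComp h g fun p => x (finProdFinEquiv p))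
        (fun a b => by by_contra hab; exact hall ⟨a, b, hab⟩)
      have h1 := hlb' _ hsol
      rw [KWTree.depth_leaf, zero_add] at h1
      have h2 : k / K ≤ c * (d * (Nat.log 2 k + 1)) := Nat.le_of_mul_le_mul_left h1 (Nat.succ_pos j)
      omega
    refine ⟨N * k, by rw [hN, pow_succ], _, hnc', hlb', ?_⟩
    refine (cktSize_blockComp_rowMajor g hck).of_le ?_
    have hNU : N * univBound k ≤ N * k * univBound k :=
      Nat.mul_le_mul_right _ (Nat.le_mul_of_pos_right N hk)
    calc N * univBound k + j * (N * univBound k) = (j + 1) * (N * univBound k) := by ring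
      _ ≤ (j + 1) * (N * k * univBound k) := Nat.mul_le_mul_left _ hNU

/-- **A hard function with a small circuit, from FRACTIONAL weak KRW.** Same conclusion as
`exists_hard_function_of_weakKRW`: for every `c₀` there are `N ≥ 1`, `h : {0,1}^N → {0,1}`, a
`B₂`-circuit `C` computing `h` and `S ≥ 1` with `⌊log₂(N + |C|)⌋ ≤ 4 S` such that every protocol for
`KW_h` has depth `> c₀ · S`.  Parameters: `d = K (c₀ + 1)` levels, inner arity `k = 2^t` with
`((c₀+1) K + c d² + c₀ d)(t+1) < 2^t`, `S = k + d (t+1)`, `N = k^d`; writing `k = K q + r` (`r < K`) the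
iteration gives depth `≥ d q − c d² (t+1) = (c₀+1)(k − r) − c d² (t+1) > c₀ k + c₀ d (t+1) = c₀ S`. -/
theorem exists_hard_function_of_weakKRWFrac {c K : ℕ}
    (hweak : ∀ m n : ℕ, 1 ≤ n → ∀ f : (Fin m → Bool) → Bool, (∃ a b, f a ≠ f b) →
      ∃ g : (Fin n → Bool) → Bool, ∀ P : KWTree (Fin m × Fin n), P.Solves (blockComp f g) →
        ∃ Q : KWTree (Fin m), Q.Solves f ∧ Q.depth + n / K ≤ P.depth + c * (Nat.log 2 (m * n) + 1))
    (hK : 0 < K) (c₀ : ℕ) :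
    ∃ N : ℕ, 1 ≤ N ∧ ∃ h : (Fin N → Bool) → Bool, ∃ C : Circuit (Fin N),
      C.IsOver B2 ∧ C.Computes h ∧ ∃ S : ℕ, 1 ≤ S ∧ Nat.log 2 (N + C.size) ≤ 4 * S ∧
        ∀ P : KWTree (Fin N), P.Solves h → c₀ * S < P.depth := by
  set d : ℕ := K * (c₀ + 1) with hd
  have hKd : K ≤ d := by rw [hd]; exact Nat.le_mul_of_pos_right K (Nat.succ_pos c₀)
  have hd1 : 1 ≤ d := hK.trans_le hKd
  obtain ⟨t, ht⟩ := exists_mul_succ_lt_two_pow ((c₀ + 1) * K + c * (d * d) + c₀ * d)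
  set k : ℕ := 2 ^ t with hkdef
  have hk : 1 ≤ k := Nat.one_le_two_pow
  have hlog : Nat.log 2 k = t := Nat.log_pow (by norm_num) t
  -- division bookkeeping: `k = K q + r`, `r < K`
  set q : ℕ := k / K with hq
  set r : ℕ := k % K with hr
  have F1 : K * q + r = k := Nat.div_add_mod k K
  have F2 : r < K := Nat.mod_lt k hK
  have hsplitA : ((c₀ + 1) * K + c * (d * d) + c₀ * d) * (t + 1) =
      c₀ * (K * (t + 1)) + K * (t + 1) + d * (c * (d * (t + 1))) + c₀ * d * (t + 1) := by ring
  rw [hsplitA] at ht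
  have F5 : r ≤ K * (t + 1) := F2.le.trans (Nat.le_mul_of_pos_right K (Nat.succ_pos t))
  have F4 : c₀ * r ≤ c₀ * (K * (t + 1)) := Nat.mul_le_mul_left c₀ F5
  have F6 : K * (c * (d * (t + 1))) ≤ d * (c * (d * (t + 1))) := Nat.mul_le_mul_right _ hKd
  have F7 : K ≤ K * (t + 1) := Nat.le_mul_of_pos_right K (Nat.succ_pos t)
  have hB : c * (d * (Nat.log 2 k + 1)) < k / K := by
    rw [hlog]
    have h8 : K * (c * (d * (t + 1))) < K * q := by
      generalize K * (c * (d * (t + 1))) = a at F6 ⊢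
      generalize d * (c * (d * (t + 1))) = D₁ at ht F6 ⊢
      generalize K * (t + 1) = δ at ht F5 F7 ⊢
      generalize c₀ * δ = γ at ht
      generalize c₀ * d * (t + 1) = D₂ at ht
      generalize K * q = u at F1 ⊢
      omega
    exact Nat.lt_of_mul_lt_mul_left h8
  obtain ⟨N, hN, h, _, hlb, hck⟩ := iterate_levels_frac hweak hk hB d le_rfl
  obtain ⟨C, hCO, hCs, hCe⟩ := hck.toCircuit
  have hN1 : 1 ≤ N := by rw [hN]; exact Nat.one_le_pow _ _ hk
  refine ⟨N, hN1, h, C, hCO, fun x => hCe x, k + d * (t + 1), by omega, ?_, fun P hP => ?_⟩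
  · -- `N + |C| ≤ k^d (1 + d · univBound k) ≤ 2^(t d) · 2^d · 2^(k+3)` (verbatim from the `+n` proof)
    have hU : univBound k ≤ 2 ^ (k + 3) :=
      Literature.Computability.MetaComplexity.Hirahara2020.univBound_le_two_pow k
    have hd2 : d + 1 ≤ 2 ^ d := Nat.lt_two_pow_self
    have hNpow : N = 2 ^ (t * d) := by rw [hN, hkdef, ← pow_mul]
    have h1 : N + C.size ≤ N * (1 + d * univBound k) := by
      have eN : N * (1 + d * univBound k) = N + d * (N * univBound k) := by ring
      rw [eN]
      exact Nat.add_le_add_left hCs N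
    have h2 : 1 + d * univBound k ≤ 2 ^ d * 2 ^ (k + 3) := by
      have h21 : 1 + d * univBound k ≤ (d + 1) * 2 ^ (k + 3) := by
        have h8 : 1 ≤ 2 ^ (k + 3) := Nat.one_le_two_pow
        have hdU : d * univBound k ≤ d * 2 ^ (k + 3) := Nat.mul_le_mul_left d hU
        have e : (d + 1) * 2 ^ (k + 3) = d * 2 ^ (k + 3) + 2 ^ (k + 3) := by ring
        rw [e]
        omega
      exact h21.trans (Nat.mul_le_mul_right _ hd2)
    have h3 : N + C.size ≤ 2 ^ (t * d + d + (k + 3)) := by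
      rw [pow_add, pow_add, ← hNpow, mul_assoc]
      exact h1.trans (Nat.mul_le_mul_left N h2)
    calc Nat.log 2 (N + C.size) ≤ Nat.log 2 (2 ^ (t * d + d + (k + 3))) := Nat.log_mono_right h3
      _ = t * d + d + (k + 3) := Nat.log_pow (by norm_num) _
      _ ≤ 4 * (k + d * (t + 1)) := by
          have hX : t * d + d = d * (t + 1) := by ring
          generalize d * (t + 1) = X at hX ⊢
          omega
  · -- depth: `d q ≤ depth + c d² (t+1)`, `d q = c₀ (K q) + K q`, `K q + r = k`, and `ht`
    have h1 := hlb P hP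
    rw [hlog] at h1
    have e1 : d * q = c₀ * (K * q) + K * q := by rw [hd]; ring
    have e2 : c₀ * (k + d * (t + 1)) = c₀ * (K * q) + c₀ * r + c₀ * d * (t + 1) := by
      rw [← F1]; ring
    rw [e2]
    rw [e1] at h1
    generalize d * (c * (d * (t + 1))) = D₁ at ht h1
    generalize K * (t + 1) = δ at ht F5 F4
    generalize c₀ * δ = γ at ht F4
    generalize c₀ * d * (t + 1) = D₂ at ht ⊢
    generalize K * q = u at F1 h1 ⊢
    generalize c₀ * u = α at h1 ⊢
    generalize c₀ * r = β at F4 ⊢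
    omega

/-! ### From hard functions with small circuits to `P ⊄ NC¹` (factored out of `CompositionIteration_proof`) -/

/-- If for every `c₀` some `h` with a `B₂`-circuit `C`, `⌊log₂(N+|C|)⌋ ≤ 4S`, needs KW depth `> c₀ S`, then
`L := CircEval.EvalLang ∈ P` is not in non-uniform `NC¹` (CVP projection `stub_cvp` + Karchmer–Wigderson
`exists_solves_of_computes`; the body of `Theorems.CompositionIteration_proof` with the iteration
abstracted into the hypothesis). -/
theorem not_NC1_of_hardFunctions
    (H : ∀ c₀ : ℕ, ∃ N : ℕ, 1 ≤ N ∧ ∃ h : (Fin N → Bool) → Bool, ∃ C : Circuit (Fin N),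
      C.IsOver B2 ∧ C.Computes h ∧ ∃ S : ℕ, 1 ≤ S ∧ Nat.log 2 (N + C.size) ≤ 4 * S ∧
        ∀ P : KWTree (Fin N), P.Solves h → c₀ * S < P.depth) :
    ∃ L ∈ Classes.P, L ∉ NC1 := by
  obtain ⟨L, hLP, c₂, hCVP⟩ := stub_cvp
  refine ⟨L, hLP, fun hLNC => ?_⟩
  simp only [NC1, NC, DepthSizeClass, Set.mem_setOf_eq] at hLNC
  obtain ⟨c', p, Cf, hCf, hdec⟩ := hLNC
  set c₀ : ℕ := 3 * c' * c₂ * 4 + 3 * c' * c₂ + 3 * c' with hc₀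
  obtain ⟨N, hN, h, C, hCO, hCc, S, hS1, hSlog, hdeep⟩ := H c₀
  obtain ⟨ℓ, hℓ, hℓlog, e, back, he, hback⟩ := hCVP N hN C hCO
  have hcomp : (Cf ℓ).Computes (L.sliceFn ℓ) := fun x => hdec.eval_eq x
  obtain ⟨P, hP, hPd⟩ := exists_solves_of_computes hℓ (Cf ℓ) (L.sliceFn ℓ) (hCf ℓ).1 hcomp
  have hQ : (P.comap e e back).Solves h :=
    solves_comap_of_embedding hP e back (fun x => (he x).trans (hCc x)) hback
  have hlt : c₀ * S < P.depth := by
    have := hdeep (P.comap e e back) hQ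
    rwa [KWTree.depth_comap] at this
  have hdepth : (Cf ℓ).acDepth ≤ c' * Nat.log 2 ℓ + c' := by
    have := (hCf ℓ).2.1
    simpa using this
  have hlog : Nat.log 2 ℓ ≤ c₂ * (4 * S + 1) :=
    hℓlog.trans (Nat.mul_le_mul_left c₂ (Nat.add_le_add_right hSlog 1))
  have hup : P.depth ≤ 3 * (c' * (c₂ * (4 * S + 1)) + c') :=
    calc P.depth ≤ 3 * (Cf ℓ).acDepth := hPd
      _ ≤ 3 * (c' * Nat.log 2 ℓ + c') := Nat.mul_le_mul_left 3 hdepth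
      _ ≤ 3 * (c' * (c₂ * (4 * S + 1)) + c') :=
          Nat.mul_le_mul_left 3 (Nat.add_le_add_right (Nat.mul_le_mul_left c' hlog) c')
  have hkey : 3 * (c' * (c₂ * (4 * S + 1)) + c') ≤ c₀ * S := by
    have e1 : 3 * (c' * (c₂ * (4 * S + 1)) + c')
        = (3 * c' * c₂ * 4) * S + (3 * c' * c₂ + 3 * c') * 1 := by ring
    have e2 : c₀ * S = (3 * c' * c₂ * 4) * S + (3 * c' * c₂ + 3 * c') * S := by
      rw [hc₀]; ring
    rw [e1, e2]
    exact Nat.add_le_add_left (Nat.mul_le_mul_left _ hS1) _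
  exact absurd (lt_of_lt_of_le hlt (hup.trans hkey)) (lt_irrefl _)

/-- **`CompositionIterationFrac` holds**: fractional weak KRW (depth form) already separates `P` from
non-uniform `NC¹` (GMWW 2017 fn. 3 (ii), proved). -/
theorem compositionIterationFrac_holds : CompositionIterationFrac := by
  rintro ⟨c, K, hK, hweak⟩
  exact not_NC1_of_hardFunctions (exists_hard_function_of_weakKRWFrac hweak hK)

/-- Sanity link: the route's `+n` support item is the `k = 1` instance (an independent second proof of
`Theorems.CompositionIteration_proof` through the fractional iteration). -/
theorem compositionIteration_of_frac :
    Summit.PneNP.PneNP.Theses.KrwChromaticSteering.CompositionIteration := by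
  unfold Summit.PneNP.PneNP.Theses.KrwChromaticSteering.CompositionIteration
  rintro ⟨c, hweak⟩
  refine compositionIterationFrac_holds ⟨c, 1, Nat.one_pos, fun m n hn f hf => ?_⟩
  obtain ⟨g, hg⟩ := hweak m n hn f hf
  refine ⟨g, fun P hP => ?_⟩
  obtain ⟨Q, hQ, hd⟩ := hg P hP
  exact ⟨Q, hQ, by simpa using hd⟩

/-! ### The door glue, now with its support item discharged -/

/-- The inner-fraction door — verbatim body of `InnerFractionDoor.StrongCompositionFrac`
(= `SliceSemiMonotone.StrongCompositionFrac`, v4). -/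
def StrongCompositionFrac : Prop :=
  ∃ c k : ℕ, 0 < k ∧ ∀ m n : ℕ, 1 ≤ n → ∀ f : (Fin m → Bool) → Bool, (∃ a b, f a ≠ f b) →
    ∃ g : (Fin n → Bool) → Bool, ∀ P : KWTree (Fin m × Fin n), P.SolvesStrong f g →
      ∃ Q : KWTree (Fin m), Q.Solves f ∧ Q.depth + n / k ≤ P.depth + c * (Nat.log 2 (m * n) + 1)

/-- C1 is the door at `k = 1`. -/
theorem strongCompositionFrac_of_strongComposition
    (h : Summit.PneNP.PneNP.Theses.KrwChromaticSteering.StrongComposition) : StrongCompositionFrac := by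
  obtain ⟨c, hc⟩ := h
  refine ⟨c, 1, Nat.one_pos, fun m n hn f hf => ?_⟩
  obtain ⟨g, hg⟩ := hc m n hn f hf
  refine ⟨g, fun P hP => ?_⟩
  obtain ⟨Q, hQ, hd⟩ := hg P hP
  exact ⟨Q, hQ, by simpa using hd⟩

/-- Door + Meir's first obstacle (`StandardFromStrong`, item 18539 unchanged) give fractional weak KRW
(proof verbatim from `InnerFractionDoor.weakKRWFrac_of`). -/
theorem weakKRWFrac_of (h1 : StrongCompositionFrac)
    (h2 : Summit.PneNP.PneNP.Theses.KrwChromaticSteering.StandardFromStrong) : WeakKRWFrac := by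
  obtain ⟨c₁, k, hk, h1⟩ := h1
  obtain ⟨c₂, h2⟩ := h2
  refine ⟨c₁ + c₂, k, hk, fun m n hn f hf => ?_⟩
  obtain ⟨g, hg⟩ := h1 m n hn f hf
  obtain ⟨g₀, hg₀⟩ := h2 m n hn f hf
  refine ⟨g₀, fun P hP => ?_⟩
  obtain ⟨P', hP', hd'⟩ := hg₀ g P hP
  obtain ⟨Q, hQ, hd⟩ := hg P' hP'
  refine ⟨Q, hQ, ?_⟩
  have hsplit : (c₁ + c₂) * (Nat.log 2 (m * n) + 1)
      = c₁ * (Nat.log 2 (m * n) + 1) + c₂ * (Nat.log 2 (m * n) + 1) := by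
    ring
  generalize n / k = q at hd ⊢
  omega

/-- **DOOR GLUE, support discharged (kernel-checked).** The inner-fraction door, the route's crux C2 and
its residual R decide the sub-problem — `CompositionIterationFrac` is no longer a hypothesis. -/
theorem closes_frac (h1 : StrongCompositionFrac)
    (h2 : Summit.PneNP.PneNP.Theses.KrwChromaticSteering.StandardFromStrong)
    (hR : Summit.PneNP.PneNP.Theses.KrwChromaticSteering.FormulaLayerLift) : PneNP := by
  refine hR fun hsub => ?_
  obtain ⟨L, hLP, hLNC⟩ := compositionIterationFrac_holds (weakKRWFrac_of h1 h2)
  exact hLNC (hsub hLP)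

/-- The route's own glue recovered through the door (C1 at `k = 1`), WITHOUT the support item S3. -/
theorem closes_via_door (h1 : Summit.PneNP.PneNP.Theses.KrwChromaticSteering.StrongComposition)
    (h2 : Summit.PneNP.PneNP.Theses.KrwChromaticSteering.StandardFromStrong)
    (hR : Summit.PneNP.PneNP.Theses.KrwChromaticSteering.FormulaLayerLift) : PneNP :=
  closes_frac (strongCompositionFrac_of_strongComposition h1) h2 hR

end Summit.PneNP.PneNP.Cruxes.StrongComposition.CompositionIterationFrac
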